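import Literature.Probability.LatticeModels.LatticeGraph
import HarnessLib

/-!
# A zero-sum periodic field is a bounded lattice divergence (Igarashi–Okuyama–Suzuki, Lemma 3.1)

H. Igarashi, K. Okuyama, H. Suzuki, *More about the axial anomaly on the lattice*,
Nucl. Phys. B 644 (2002) 383, arXiv:hep-lat/0206003, §3, Lemma 3.1 with the explicit
construction (3.9): on the periodic lattice `Γ = (ℤ/Lℤ)^d` every field `c` with `Σ_{x∈Γ} c(x) = 0`
is a backward divergence, `c = ∂*_μ b_μ` (`∂*_μ f(x) = f(x) − f(x − μ̂)`), of a periodic current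
`b_μ` which is "a sum of `c(y)`" and obeys the uniform bound `|b_μ(x)| ≤ 2L max_Γ |c|`. This is
the finite-volume substitute for the Poincaré lemma used in the proof of IOS Theorem 3.1 (the
`L`-linear bound is what makes the exponentially small difference `𝒜 − 𝒜^∞` of anomaly densities
a divergence of an exponentially small current); it is vendored here as the step "(F)" of the
proof of `Literature.MathematicalPhysics.QuantumLattice.IOSFluxSectorIndex`
(`AbelianFluxSectors.lean`).

The construction, in coordinates `0, …, d−1` (IOS number them `1, …, d`): let
`A_j c (x) = L^{-(d−j)} Σ_{y : yᵢ = xᵢ (i < j)} c(y)` be the average of `c` over the coordinates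
`≥ j` (`tailAvg`), so `A_d c = c` and `A_0 c = L^{-d} Σ_Γ c = 0`; the differences
`g_j = A_{j+1} c − A_j c` (`tailAvgDiff`) telescope to `c` and have zero sum along the `j`-th
coordinate line, hence the prefix sums `b_j(x) = Σ_{s=0}^{x_j} g_j(x|_{x_j := s})` (`iosCurrent`,
literally IOS (3.9)) are periodic with `∂*_j b_j = g_j`, and `|b_j| ≤ L · 2 max|c|`.

Main result: `exists_backwardDivergence_eq_of_sum_eq_zero` (and the explicit form
`backwardDivergence_iosCurrent`, `abs_iosCurrent_le`).

## References

* H. Igarashi, K. Okuyama, H. Suzuki, Nucl. Phys. B 644 (2002) 383–394, arXiv:hep-lat/0206003,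
  §3, Lemma 3.1, eqs. (3.7)–(3.9). [IgarashiOkuyamaSuzuki2002]
-/

noncomputable section

open Finset Function
open Literature.Probability.LatticeModels (TorusSite)

namespace Literature.MathematicalPhysics.QuantumLattice

namespace TorusDivergence

variable {d L : ℕ} [NeZero L]

/-! ### Partial averages over the trailing coordinates -/

/-- The sites agreeing with `x` on the coordinates `< j`. [folklore] -/
def agreeBelow (j : ℕ) (x : TorusSite d L) : Finset (TorusSite d L) :=
  univ.filter fun y => ∀ i : Fin d, (i : ℕ) < j → y i = x i

/-- Membership in the agreement class. [folklore] -/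
theorem mem_agreeBelow {j : ℕ} {x y : TorusSite d L} :
    y ∈ agreeBelow j x ↔ ∀ i : Fin d, (i : ℕ) < j → y i = x i := by
  simp [agreeBelow]

/-- No constraint below `0`: the whole torus. [folklore] -/
theorem agreeBelow_zero (x : TorusSite d L) : agreeBelow 0 x = univ := by
  ext y
  simp [mem_agreeBelow]

/-- All coordinates constrained: the class is `{x}`. [folklore] -/
theorem agreeBelow_of_le {j : ℕ} (hj : d ≤ j) (x : TorusSite d L) : agreeBelow j x = {x} := by
  ext y
  simp only [mem_agreeBelow, mem_singleton]
  refine ⟨fun h => funext fun i => h i (lt_of_lt_of_le i.isLt hj), ?_⟩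
  rintro rfl i _
  rfl

/-- Changing a coordinate `≥ j` of the base point does not change the agreement class.
[folklore] -/
theorem agreeBelow_update_of_le {j : ℕ} {i : Fin d} (hj : j ≤ i) (x : TorusSite d L)
    (t : ZMod L) : agreeBelow j (update x i t) = agreeBelow j x := by
  ext y
  simp only [mem_agreeBelow]
  refine forall_congr' fun k => imp_congr_right fun hk => ?_
  rw [update_of_ne (Fin.ne_of_lt (Fin.lt_def.mpr (lt_of_lt_of_le hk hj)))]

/-- The fibres of `y ↦ y_j` on the agreement class below `j` are the agreement classes below
`j + 1`. [folklore] -/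
theorem filter_agreeBelow_apply_eq (j : Fin d) (x : TorusSite d L) (t : ZMod L) :
    (agreeBelow j x).filter (fun y => y j = t) = agreeBelow (j + 1) (update x j t) := by
  ext y
  simp only [mem_filter, mem_agreeBelow]
  constructor
  · rintro ⟨h, hy⟩ i hi
    rcases Nat.lt_succ_iff_lt_or_eq.mp hi with hi | hi
    · rw [update_of_ne (Fin.ne_of_lt (Fin.lt_def.mpr hi))]
      exact h i hi
    · have : i = j := Fin.ext hi
      subst this
      rw [update_self]
      exact hy
  · intro h
    refine ⟨fun i hi => ?_, ?_⟩
    · have := h i (Nat.lt_succ_of_lt hi)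
      rwa [update_of_ne (Fin.ne_of_lt (Fin.lt_def.mpr hi))] at this
    · have := h j (Nat.lt_succ_self _)
      rwa [update_self] at this

/-- Summing over the agreement class below `j` = summing over `t` and then over the class below
`j + 1` of `x|_{x_j := t}` (Fubini for the nested sums in IOS (3.9)). [folklore] -/
theorem sum_agreeBelow_eq_sum_update (j : Fin d) (c : TorusSite d L → ℝ) (x : TorusSite d L) :
    ∑ y ∈ agreeBelow j x, c y = ∑ t : ZMod L, ∑ y ∈ agreeBelow (j + 1) (update x j t), c y := by
  rw [← Finset.sum_fiberwise (agreeBelow j x) (fun y => y j) c]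
  refine Finset.sum_congr rfl fun t _ => ?_
  rw [filter_agreeBelow_apply_eq]

/-- **Partial average** `A_j c (x) = L^{-(d−j)} Σ_{y : yᵢ = xᵢ (i<j)} c(y)`: the average of `c` over
the coordinates `≥ j` with the coordinates `< j` frozen at `x`. [cite: IgarashiOkuyamaSuzuki2002,
eq. (3.9)] -/
def tailAvg (j : ℕ) (c : TorusSite d L → ℝ) (x : TorusSite d L) : ℝ :=
  ((L : ℝ) ^ (d - j))⁻¹ * ∑ y ∈ agreeBelow j x, c y

/-- `A_d c = c`. [folklore] -/
theorem tailAvg_of_le {j : ℕ} (hj : d ≤ j) (c : TorusSite d L → ℝ) (x : TorusSite d L) :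
    tailAvg j c x = c x := by
  rw [tailAvg, agreeBelow_of_le hj, sum_singleton, Nat.sub_eq_zero_of_le hj, pow_zero, inv_one,
    one_mul]

/-- `A_0 c = L^{-d} Σ_Γ c`. [folklore] -/
theorem tailAvg_zero (c : TorusSite d L → ℝ) (x : TorusSite d L) :
    tailAvg 0 c x = ((L : ℝ) ^ d)⁻¹ * ∑ y, c y := by
  rw [tailAvg, agreeBelow_zero, Nat.sub_zero]

/-- `A_j c` does not depend on the coordinates `≥ j`. [folklore] -/
theorem tailAvg_update_of_le {j : ℕ} {i : Fin d} (hj : j ≤ i) (c : TorusSite d L → ℝ)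
    (x : TorusSite d L) (t : ZMod L) : tailAvg j c (update x i t) = tailAvg j c x := by
  rw [tailAvg, tailAvg, agreeBelow_update_of_le hj]

/-- `A_j c` is the average of `A_{j+1} c` along the `j`-th coordinate line:
`Σ_t A_{j+1} c (x|_{x_j := t}) = L · A_j c (x)`. [folklore] -/
theorem sum_tailAvg_succ_update (j : Fin d) (c : TorusSite d L → ℝ) (x : TorusSite d L) :
    ∑ t : ZMod L, tailAvg (j + 1) c (update x j t) = L * tailAvg j c x := by
  simp only [tailAvg]
  rw [← Finset.mul_sum, ← sum_agreeBelow_eq_sum_update]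
  have hL : (L : ℝ) ≠ 0 := Nat.cast_ne_zero.mpr (NeZero.ne L)
  have hdj : d - j = (d - (j + 1)) + 1 := by omega
  rw [hdj, pow_succ]
  field_simp

/-- `|A_j c| ≤ max |c|` (an average), by downward induction on `j` from `A_d c = c`.
[folklore] -/
theorem abs_tailAvg_le {c : TorusSite d L → ℝ} {M : ℝ} (hM : ∀ y, |c y| ≤ M) :
    ∀ (k j : ℕ), j + k = d → ∀ x, |tailAvg j c x| ≤ M := by
  intro k
  induction k with
  | zero =>
    intro j hj x
    rw [tailAvg_of_le (by omega)]
    exact hM x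
  | succ k ih =>
    intro j hj x
    have hjd : j < d := by omega
    have key : ∑ t : ZMod L, tailAvg (j + 1) c (update x ⟨j, hjd⟩ t) = L * tailAvg j c x :=
      sum_tailAvg_succ_update (⟨j, hjd⟩ : Fin d) c x
    have hL : (0 : ℝ) < L := Nat.cast_pos.mpr (NeZero.pos L)
    have h1 : |(L : ℝ) * tailAvg j c x| ≤ L * M := by
      rw [← key]
      refine (Finset.abs_sum_le_sum_abs _ _).trans ?_
      calc ∑ t : ZMod L, |tailAvg (j + 1) c (update x ⟨j, hjd⟩ t)|
          ≤ ∑ _t : ZMod L, M := Finset.sum_le_sum fun t _ => ih (j + 1) (by omega) _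
        _ = L * M := by rw [sum_const, card_univ, ZMod.card, nsmul_eq_mul]
    rw [abs_mul, Nat.abs_cast] at h1
    exact le_of_mul_le_mul_left h1 hL

/-- `|A_j c| ≤ max |c|` for `j ≤ d`. [folklore] -/
theorem abs_tailAvg_le' {c : TorusSite d L → ℝ} {M : ℝ} (hM : ∀ y, |c y| ≤ M) {j : ℕ}
    (hj : j ≤ d) (x : TorusSite d L) : |tailAvg j c x| ≤ M :=
  abs_tailAvg_le hM (d - j) j (by omega) x

/-! ### The zero-mean pieces and their telescoping -/

/-- `g_j = A_{j+1} c − A_j c`. [cite: IgarashiOkuyamaSuzuki2002, eq. (3.9)] -/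
def tailAvgDiff (j : Fin d) (c : TorusSite d L → ℝ) (x : TorusSite d L) : ℝ :=
  tailAvg (j + 1) c x - tailAvg j c x

/-- `Σ_j g_j = A_d c − A_0 c = c − L^{-d} Σ_Γ c` (telescoping). [folklore] -/
theorem sum_tailAvgDiff (c : TorusSite d L → ℝ) (x : TorusSite d L) :
    ∑ j : Fin d, tailAvgDiff j c x = c x - ((L : ℝ) ^ d)⁻¹ * ∑ y, c y := by
  have h := Fin.sum_univ_eq_sum_range (fun j => tailAvg (j + 1) c x - tailAvg j c x) d
  have h2 := Finset.sum_range_sub (fun i => tailAvg i c x) d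
  simp only [tailAvgDiff]
  rw [h, h2, tailAvg_of_le (le_refl d), tailAvg_zero]

/-- `g_j` has zero sum along the `j`-th coordinate line. [folklore] -/
theorem sum_tailAvgDiff_update (j : Fin d) (c : TorusSite d L → ℝ) (x : TorusSite d L) :
    ∑ t : ZMod L, tailAvgDiff j c (update x j t) = 0 := by
  simp only [tailAvgDiff, Finset.sum_sub_distrib, sum_tailAvg_succ_update,
    tailAvg_update_of_le (le_refl (j : ℕ))]
  rw [sum_const, card_univ, ZMod.card, nsmul_eq_mul, sub_self]

/-- `|g_j| ≤ 2 max|c|`. [folklore] -/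
theorem abs_tailAvgDiff_le {c : TorusSite d L → ℝ} {M : ℝ} (hM : ∀ y, |c y| ≤ M) (j : Fin d)
    (x : TorusSite d L) : |tailAvgDiff j c x| ≤ 2 * M := by
  rw [tailAvgDiff]
  refine (abs_sub _ _).trans ?_
  have h1 := abs_tailAvg_le' hM (j := j + 1) (by omega) x
  have h2 := abs_tailAvg_le' hM (j := j) (by omega) x
  linarith

/-! ### Prefix sums along a coordinate line and the backward difference -/

/-- Prefix sum of `g` along the `j`-th coordinate line up to `x_j` (representatives `0, …, L−1`):
`P g (x) = Σ_{s=0}^{x_j} g(x|_{x_j := s})` (the outer sum `Σ_{y_μ=0}^{x_μ}` of IOS (3.9)).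
[cite: IgarashiOkuyamaSuzuki2002, eq. (3.9)] -/
def prefixSum (g : TorusSite d L → ℝ) (j : Fin d) (x : TorusSite d L) : ℝ :=
  ∑ s ∈ range ((x j).val + 1), g (update x j (s : ZMod L))

omit [NeZero L] in
/-- Overwriting the `j`-th coordinate forgets a shift in direction `j`. [folklore] -/
theorem update_sub_single (x : TorusSite d L) (j : Fin d) (s : ZMod L) :
    update (x - Pi.single j 1) j s = update x j s := by
  funext k
  by_cases hk : k = j
  · subst hk
    simp
  · simp [hk]

/-- Reindexing a sum over `ZMod L` by the representatives `0, …, L − 1`. [folklore] -/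
theorem sum_range_natCast_zmod (G : ZMod L → ℝ) :
    ∑ s ∈ range L, G (s : ZMod L) = ∑ t : ZMod L, G t := by
  have himage : (univ : Finset (ZMod L)).image ZMod.val = range L := by
    ext s
    simp only [mem_image, mem_univ, true_and, mem_range]
    constructor
    · rintro ⟨t, rfl⟩
      exact ZMod.val_lt t
    · intro hs
      exact ⟨s, ZMod.val_cast_of_lt hs⟩
  rw [← himage, Finset.sum_image fun t _ t' _ h => ZMod.val_injective L h]
  refine Finset.sum_congr rfl fun t _ => ?_
  rw [ZMod.natCast_zmod_val]

/-- **`∂*_j P g = g`** for a line-periodic prefix sum: if `g` has zero sum along the `j`-th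
coordinate line through `x`, then `P g (x) − P g (x − ĵ) = g(x)` (at `x_j = 0` the prefix sum
wraps around to the full, vanishing, line sum). [folklore] -/
theorem prefixSum_sub_prefixSum (g : TorusSite d L → ℝ) (j : Fin d) (x : TorusSite d L)
    (hg : ∑ t : ZMod L, g (update x j t) = 0) :
    prefixSum g j x - prefixSum g j (x - Pi.single j 1) = g x := by
  simp only [prefixSum, update_sub_single, Pi.sub_apply, Pi.single_eq_same]
  rcases Nat.eq_zero_or_pos (x j).val with h0 | hpos
  · -- wrap-around case `x_j = 0`
    have hx0 : x j = 0 := (ZMod.val_eq_zero _).mp h0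
    have h1 : (x j - 1).val + 1 = L := by
      rw [hx0, zero_sub, ZMod.neg_val]
      split_ifs with h
      · have hL1 : L = 1 := ZMod.one_eq_zero_iff.mp h
        omega
      · rw [ZMod.val_one'' (fun hL1 => h (ZMod.one_eq_zero_iff.mpr hL1))]
        have := NeZero.pos L
        omega
    rw [h0, h1, zero_add, sum_range_one, Nat.cast_zero, ← hx0, update_eq_self,
      sum_range_natCast_zmod (fun t => g (update x j t)), hg, sub_zero]
  · -- generic case `x_j ≥ 1`
    have hL1 : L ≠ 1 := by
      intro hL1
      have := ZMod.val_lt (x j)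
      omega
    have h1 : (x j - 1).val = (x j).val - 1 := by
      rw [ZMod.val_sub] <;> rw [ZMod.val_one'' hL1]
      exact hpos
    rw [h1, Nat.sub_add_cancel hpos, Finset.sum_range_succ, ZMod.natCast_zmod_val, update_eq_self,
      add_sub_cancel_left]

/-- `|P g| ≤ L max|g|` (at most `L` terms). [folklore] -/
theorem abs_prefixSum_le {g : TorusSite d L → ℝ} {B : ℝ} (hB : ∀ y, |g y| ≤ B) (j : Fin d)
    (x : TorusSite d L) : |prefixSum g j x| ≤ L * B := by
  have hB0 : 0 ≤ B := (abs_nonneg _).trans (hB x)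
  rw [prefixSum]
  refine (Finset.abs_sum_le_sum_abs _ _).trans ?_
  calc ∑ s ∈ range ((x j).val + 1), |g (update x j (s : ZMod L))|
      ≤ ∑ _s ∈ range ((x j).val + 1), B := Finset.sum_le_sum fun s _ => hB _
    _ = ((x j).val + 1 : ℕ) * B := by rw [sum_const, card_range, nsmul_eq_mul]
    _ ≤ L * B := by
        refine mul_le_mul_of_nonneg_right ?_ hB0
        exact_mod_cast ZMod.val_lt (x j)

/-! ### The IOS current and Lemma 3.1 -/

/-- **The IOS current (3.9)**: `b_j(x) = Σ_{s=0}^{x_j} (A_{j+1} c − A_j c)(x|_{x_j := s})`, i.e.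
`L^{-(d-j-1)} Σ_{y_j ≤ x_j} Σ_{y_{>j}} c(x_{<j}, y_{≥j}) − (x_j + 1) L^{-(d-j)} Σ_{y_{≥ j}} c(x_{<j}, y_{≥j})`.
[cite: IgarashiOkuyamaSuzuki2002, eq. (3.9)] -/
def iosCurrent (c : TorusSite d L → ℝ) (j : Fin d) (x : TorusSite d L) : ℝ :=
  prefixSum (tailAvgDiff j c) j x

/-- `∂*_j b_j = g_j` componentwise. [cite: IgarashiOkuyamaSuzuki2002, eqs. (3.8)–(3.9)] -/
theorem iosCurrent_sub_iosCurrent (c : TorusSite d L → ℝ) (j : Fin d) (x : TorusSite d L) :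
    iosCurrent c j x - iosCurrent c j (x - Pi.single j 1) = tailAvgDiff j c x :=
  prefixSum_sub_prefixSum _ j x (sum_tailAvgDiff_update j c x)

/-- **`∂*_μ b_μ = c − L^{-d} Σ_Γ c`** for the IOS current (so `∂*_μ b_μ = c` under (3.7)).
[cite: IgarashiOkuyamaSuzuki2002, eqs. (3.7)–(3.9)] -/
theorem backwardDivergence_iosCurrent (c : TorusSite d L → ℝ) (x : TorusSite d L) :
    ∑ μ : Fin d, (iosCurrent c μ x - iosCurrent c μ (x - Pi.single μ 1)) =
      c x - ((L : ℝ) ^ d)⁻¹ * ∑ y, c y := by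
  simp only [iosCurrent_sub_iosCurrent, sum_tailAvgDiff]

/-- **`|b_μ(x)| ≤ 2L max|c|`** for the IOS current. [cite: IgarashiOkuyamaSuzuki2002, eq. (3.8)] -/
theorem abs_iosCurrent_le {c : TorusSite d L → ℝ} {M : ℝ} (hM : ∀ y, |c y| ≤ M) (μ : Fin d)
    (x : TorusSite d L) : |iosCurrent c μ x| ≤ 2 * L * M := by
  have h := abs_prefixSum_le (fun y => abs_tailAvgDiff_le hM μ y) μ x
  rw [iosCurrent]
  linarith

end TorusDivergence

open TorusDivergence in
/-- **Igarashi–Okuyama–Suzuki, Lemma 3.1.** For a periodic field `c` on `Γ = (ℤ/Lℤ)^d` with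
`Σ_{x∈Γ} c(x) = 0` there is a periodic current `b_μ` — a sum of values of `c`, explicitly the IOS
current (3.9) — with `∂*_μ b_μ(x) = Σ_μ (b_μ(x) − b_μ(x − μ̂)) = c(x)` and
`|b_μ(x)| ≤ 2L max_Γ |c|` (stated for every bound `M` of `|c|`).
[cite: IgarashiOkuyamaSuzuki2002, §3, Lemma 3.1, eqs. (3.7)–(3.9)] -/
theorem exists_backwardDivergence_eq_of_sum_eq_zero {d L : ℕ} [NeZero L]
    (c : TorusSite d L → ℝ) (hc : ∑ x, c x = 0) :
    ∃ b : Fin d → TorusSite d L → ℝ,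
      (∀ x, ∑ μ : Fin d, (b μ x - b μ (x - Pi.single μ 1)) = c x) ∧
      ∀ M : ℝ, (∀ y, |c y| ≤ M) → ∀ μ x, |b μ x| ≤ 2 * L * M := by
  refine ⟨iosCurrent c, fun x => ?_, fun M hM μ x => abs_iosCurrent_le hM μ x⟩
  rw [backwardDivergence_iosCurrent, hc, mul_zero, sub_zero]

end Literature.MathematicalPhysics.QuantumLattice
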